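import Summits.BirchSwinnertonDyer.Rank1Residual.X11a.SelmerCompanionRankOnePartner
import HarnessLib

/-!
# Route (3e) SELMER COMPANION, XVI: strict places in general — the mirror place (`E` good, `A`
# split), the prime-order certificate, and shape D with an abstract killing place
# (class X11a = N7; cell `b2b-bsdres`, unit `b2b-bsdres-x11a`, gen 28)

HONEST FRAMING (run/shared/lean/b2b/bsd-rank1-residual/, verbatim in every file): the goal of the
cell is to DELETE the COMBINATION-SHAPED residual classes of the Birch–Swinnerton-Dyer formula for
ALL analytic-rank `≤ 1` elliptic curves over `ℚ` — "full BSD formula for every rank `≤ 1` curve in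
class `C`" assembled STRICTLY from published theorems — so that the rank-`≤ 1` remainder becomes
exactly the CONSTRUCTION-SHAPED classes, which are TYPED (missing-input `Prop`s), NOT attempted.
This is not "finishing BSD". CLASS-OWNERS.md: research routes; NO CLAIM BEYOND STATED CLASSES.
THEOREMS ONLY; nothing booked; no label moves. CONDITIONAL on the PUBLISHED binders GZK, Cassels–Tate,
A40/A41 (Tate uniformisation), Milne I.2.8 (`hEP`) where they are hypotheses.

## What this file proves

* `res_h1Equiv_eq_zero_of_good_of_split` — the MIRROR of file XIV's strict place: `θ : E[p] ≃ A[p]`,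
  `v ∤ p`, `p ∤ q_v − 1`, `E` GOOD and the partner `A` SPLIT multiplicative at `v` (a level-RAISED
  partner at `v`; `ι_v(θ) = p`, sharp): every class of `θ_* 𝓢_v(E) ∩ 𝓢_v(A)` restricts to zero in
  `H¹(K_v, A[p])` (Selmer for the good `E` ⟹ unramified; file XIV applied to `A`).
* `strict_of_natCard_selmerGroup_eq_prime` — **the prime-order certificate**: if `#Sel^(p)(A/K) = p`
  and SOME Selmer class restricts non-trivially to `H¹(K_w, A[p])`, then `Sel^(p)(A) → H¹(K_w, A[p])`
  is injective (any non-zero element of a group of prime order generates it). For a closed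
  rank-one partner (`#Sel^(p)(A) = p^{r_an(A)} = p`, tree `natCard_selmerGroup_eq_pow_of_bsdp`) the
  witness is the Kummer class of a generator that is not `p`-divisible in `A(K_w)`.
* `bsdp_of_selmerCompanion_kill_six_kinds` — shape D of file XV with the strict place abstracted to
  a KILLING hypothesis `hkill : ∀ c ∈ 𝓢_{v₀}(E), θ_* c ∈ 𝓢_{v₀}(A) → res_{v₀}(θ_* c) = 0`; file XIV
  (`E` split, `A` good) and the mirror lemma above (`E` good, `A` split) are its two instances over
  `ℚ` (the latter covers e.g. the leaf cell `184960bn1 ← 110976v1` at `p = 5`, whose certificate is a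
  component-group computation on the partner — not yet run by the census).

References: files XII–XV; [MazurRubin2004] §2.3; [SilvermanATAEC1994] V 3.1, 5.3; [GrossLMS1991]
(7.1); HOME/b2b-bsdres-x11a/REPORT-g28.md.
-/

set_option autoImplicit false

noncomputable section

open scoped Classical NNReal

open WeierstrassCurve Literature.NumberTheory.EllipticCurves
  Literature.NumberTheory.GaloisRepresentations Field NumberField IsDedekindDomain
  IsDedekindDomain.HeightOneSpectrum
  Literature.NumberTheory.EllipticCurves.Rank1Residual
  Literature.NumberTheory.EllipticCurves.Rank1Residual.Typed

namespace Summit.BirchSwinnertonDyer.Rank1Residual.X11a.SelmerCompanion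

section Local

variable {K : Type} [Field K] [NumberField K] (W : WeierstrassCurve K) [W.IsElliptic]
  {p : ℕ} [hp : Fact p.Prime] (v : HeightOneSpectrum (𝓞 K))

/-- **The mirror strict place: `E` GOOD, the partner `A` SPLIT multiplicative at `v ∤ p` with
`p ∤ q_v − 1`.** Along `θ : E[p] ≃ A[p]`, every class of `θ_* 𝓢_v(E) ∩ 𝓢_v(A)` restricts to zero in
`H¹(K_v, A[p])`: its preimage is Selmer for the good curve `E`, hence unramified (Gross (7.1), tree
`selmerLocalKer_eq_unramifiedKer`), so the class itself is unramified (transport) and Selmer for the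
split curve `A`, hence locally zero (file XIV, `res_eq_zero_of_split_of_selmer_of_unramified`).
[cite: SilvermanATAEC1994, Ch. V Thm. 3.1 (c),(d), Thm. 5.3 (a),(b)] [cite: GrossLMS1991, §7 (7.1)] -/
theorem res_h1Equiv_eq_zero_of_good_of_split
    (hU : Silverman1994_thmV53_tateUniformisation.{0})
    (A : WeierstrassCurve K) [A.IsElliptic]
    (θ : geomTorsion W (p : ℤ) ≃+ geomTorsion A (p : ℤ))
    (hθ : ∀ (σ : absoluteGaloisGroup K) (P : geomTorsion W (p : ℤ)), θ (σ • P) = σ • θ P)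
    (hW : W.HasGoodReductionAt v) (hA : A.HasSplitMultiplicativeReductionAt v)
    (hpv : (p : 𝓞 K) ∉ v.asIdeal)
    (hq : ¬ p ∣ Nat.card (IsLocalRing.ResidueField (v.adicCompletionIntegers K)) - 1)
    {c : galH1Torsion W (p : ℤ)} (hc : c ∈ selmerLocalKer W (v.adicCompletion K) (p : ℤ))
    (hcA : h1Equiv θ hθ c ∈ selmerLocalKer A (v.adicCompletion K) (p : ℤ)) :
    galoisCohomology.res (A.torsionGaloisModule (p : ℤ)) (v.adicCompletion K) 1 (h1Equiv θ hθ c) =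
      0 := by
  obtain ⟨𝔐, h𝔐⟩ := v.localPrimesAbove_nonempty
  have h𝔓 := HeightOneSpectrum.primeBelow_mem_primesAbove
    (ι := closureEmb (K := K) (v.adicCompletion K)) h𝔐
  have hpv' : (((p : ℤ)) : 𝓞 K) ∉ v.asIdeal := by rwa [Int.cast_natCast]
  have hur : c ∈ unramifiedKer (geomTorsion W (p : ℤ))
      (v.primeBelow (closureEmb (K := K) (v.adicCompletion K)) 𝔐) := by
    rw [← W.selmerLocalKer_eq_unramifiedKer hW hpv' h𝔓]
    exact hc
  exact res_eq_zero_of_split_of_selmer_of_unramified A v hU hA hpv hq h𝔐 hcA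
    ((mem_unramifiedKer_iff_h1Equiv_mem A W θ hθ _ c).mp hur)

omit [W.IsElliptic] in
/-- **The prime-order certificate.** If `#Sel^(p)(A/K) = p` (a closed rank-one partner:
`#Sel^(p) = p^{r_an}`, tree `natCard_selmerGroup_eq_pow_of_bsdp`) and some class `s ∈ Sel^(p)(A/K)`
restricts NON-trivially to `H¹(L, A[p])` (`L` a `K`-field, e.g. `K_w`), then every class of
`Sel^(p)(A/K)` restricting to zero there is zero: a non-zero element of a group of prime order
generates it (Mathlib `mem_zmultiples_of_prime_card`). [folklore] -/
theorem strict_of_natCard_selmerGroup_eq_prime (L : Type) [Field L] [Algebra K L]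
    (hcard : Nat.card (W.selmerGroup (p : ℤ)) = p)
    {s : galH1Torsion W (p : ℤ)} (hs : s ∈ W.selmerGroup (p : ℤ))
    (hres : galoisCohomology.res (W.torsionGaloisModule (p : ℤ)) L 1 s ≠ 0)
    {d : galH1Torsion W (p : ℤ)} (hd : d ∈ W.selmerGroup (p : ℤ))
    (hd0 : galoisCohomology.res (W.torsionGaloisModule (p : ℤ)) L 1 d = 0) : d = 0 := by
  by_contra hne
  have hne' : (⟨d, hd⟩ : W.selmerGroup (p : ℤ)) ≠ 0 := fun h ↦ hne (congrArg Subtype.val h)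
  have hmem : (⟨s, hs⟩ : W.selmerGroup (p : ℤ)) ∈
      AddSubgroup.zmultiples (⟨d, hd⟩ : W.selmerGroup (p : ℤ)) :=
    mem_zmultiples_of_prime_card hcard hne'
  obtain ⟨k, hk⟩ := AddSubgroup.mem_zmultiples_iff.mp hmem
  -- restriction composed with the inclusion of the Selmer group (a homomorphism on the subgroup)
  let r' := (galoisCohomology.res (W.torsionGaloisModule (p : ℤ)) L 1).comp
    (W.selmerGroup (p : ℤ)).subtype
  have hr'd : r' ⟨d, hd⟩ = 0 := hd0
  have hr's : r' ⟨s, hs⟩ ≠ 0 := hres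
  apply hr's
  rw [← hk, map_zsmul, hr'd, smul_zero]

end Local

/-! ### Over `ℚ`: shape D with an abstract killing place -/

section Rat

variable (W A : WeierstrassCurve ℚ) [W.IsElliptic] [W.IsGloballyMinimal] [A.IsElliptic]
  [A.IsGloballyMinimal] (p : ℕ) [hp : Fact p.Prime]

/-- **Shape D with an abstract killing place.** As `bsdp_of_selmerCompanion_strict_six_kinds`
(file XV), with the strict place `v₀` described only by its effect
`hkill : ∀ c ∈ 𝓢_{v₀}(E), θ_* c ∈ 𝓢_{v₀}(A) → res_{v₀}(θ_* c) = 0` (here `θ : E[p] ≃ A[p]` is the datum, the inverse of certificate C1) — supplied over `ℚ` by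
file XIV (`E` split multiplicative, `A` good, `v₀ ∤ p`, `p ∤ ℓ₀ − 1`) or by
`res_h1Equiv_eq_zero_of_good_of_split` (`E` good, `A` split multiplicative) — and the injectivity
`hstrict` of `Sel^(p)(A) → H¹(ℚ_{v₀}, A[p])`: if the places of `S \ T` are of the six kinds and
`∏_{v∈T} #E(ℚ_v)[p]·#(ℤ_v/p) ≤ p` then `BSD(E,p)` (rank-`0` pair, `p` odd, `E[p]` irreducible,
`p ∤ #Ш_an(E)`). No hypothesis on `A` beyond `hstrict`. Binders GZK, Cassels–Tate, A40/A41,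
Milne I.2.8. Not a class theorem; nothing booked. [cite: MazurRubin2004, §2.3]
[cite: Miller2011LMS, §1 and Def. 1.1] [cite: SilvermanATAEC1994, Ch. V Thm. 3.1, Lemma 5.2, Thm. 5.3, Cor. 5.4, Ex. 5.11]
[cite: GreenbergLNM1716, §2 Props. 2.2, 2.4] [cite: MilneADT2006, Ch. I §2 Thm. 2.8, Prop. 3.8] -/
theorem bsdp_of_selmerCompanion_kill_six_kinds
    (hU : Silverman1994_thmV53_tateUniformisation.{0})
    (hU2 : Silverman1994_thmV53_corV54_tateUniformisation.{0})
    (hEP : ∀ v : HeightOneSpectrum (𝓞 ℚ), (p : 𝓞 ℚ) ∈ v.asIdeal →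
      localEulerPoincareCharacteristic (v.adicCompletion ℚ))
    (hGZK : rank_eq_analyticRank_of_analyticRank_le_one)
    (hCT : exists_casselsTate_pairing (K := ℚ)) (hp2 : p ≠ 2)
    (hr : W.analyticRank = 0) (hirr : Irr W p) (hSha : X11a.ShaAnUnit W p)
    (θ : geomTorsion W (p : ℤ) ≃+ geomTorsion A (p : ℤ))
    (hθ : ∀ (σ : absoluteGaloisGroup ℚ) (P : geomTorsion W (p : ℤ)), θ (σ • P) = σ • θ P)
    (S T : Finset (HeightOneSpectrum (𝓞 ℚ))) (hTS : T ⊆ S)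
    (hS : ∀ v : HeightOneSpectrum (𝓞 ℚ), v ∉ S →
      A.HasGoodReductionAt v ∧ W.HasGoodReductionAt v ∧ (p : 𝓞 ℚ) ∉ v.asIdeal)
    (hplaces : ∀ v ∈ S, v ∉ T →
      ((p : 𝓞 ℚ) ∉ v.asIdeal ∧ Nat.card (nsmulAddMonoidHom p :
          (W.baseChange (v.adicCompletion ℚ)).toAffine.Point →+ _).ker = 1) ∨
      (A.HasSplitMultiplicativeReductionAt v ∧ W.HasSplitMultiplicativeReductionAt v ∧
        Nat.card (nsmulAddMonoidHom p :
          (A.baseChange (v.adicCompletion ℚ)).toAffine.Point →+ _).ker ≤ p) ∨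
      (A.HasMultiplicativeReductionAt v ∧ W.HasMultiplicativeReductionAt v ∧
        (∃ r : v.adicCompletion ℚ, algebraMap ℚ (v.adicCompletion ℚ) (-(A.c₄ / A.c₆)) =
          r ^ 2 * algebraMap ℚ (v.adicCompletion ℚ) (-(W.c₄ / W.c₆))) ∧
        (∀ ζ : v.adicCompletion ℚ, ζ ^ p = 1 → ζ = 1)) ∨
      (∃ (ℓ : ℕ) (_ : Fact ℓ.Prime), ℓ ≠ 2 ∧ (ℓ : 𝓞 ℚ) ∈ v.asIdeal ∧ (p : 𝓞 ℚ) ∉ v.asIdeal ∧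
        W.HasMultiplicativeReductionAtPrime ℓ ∧
        (∀ r : v.adicCompletion ℚ, algebraMap ℚ (v.adicCompletion ℚ) (-(W.c₄ / W.c₆)) ≠ r ^ 2) ∧
        A.HasGoodReductionAt v) ∨
      ((p : 𝓞 ℚ) ∈ v.asIdeal ∧ W.HasMultiplicativeReductionAtPrime p ∧
        (∀ r : v.adicCompletion ℚ, algebraMap ℚ (v.adicCompletion ℚ) (-(W.c₄ / W.c₆)) ≠ r ^ 2) ∧
        A.HasGoodReductionAtPrime p) ∨
      (∃ (ℓ : ℕ) (_ : Fact ℓ.Prime), ℓ ≠ 2 ∧ (ℓ : 𝓞 ℚ) ∈ v.asIdeal ∧ (p : 𝓞 ℚ) ∉ v.asIdeal ∧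
        W.HasGoodReductionAt v ∧ A.HasMultiplicativeReductionAtPrime ℓ ∧
        (∀ r : v.adicCompletion ℚ, algebraMap ℚ (v.adicCompletion ℚ) (-(A.c₄ / A.c₆)) ≠ r ^ 2)))
    {v₀ : HeightOneSpectrum (𝓞 ℚ)}
    (hkill : ∀ c ∈ selmerLocalKer W (v₀.adicCompletion ℚ) (p : ℤ),
      h1Equiv θ hθ c ∈ selmerLocalKer A (v₀.adicCompletion ℚ) (p : ℤ) →
      galoisCohomology.res (A.torsionGaloisModule (p : ℤ)) (v₀.adicCompletion ℚ) 1
        (h1Equiv θ hθ c) = 0)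
    (hstrict : ∀ d ∈ A.selmerGroup (p : ℤ),
      galoisCohomology.res (A.torsionGaloisModule (p : ℤ)) (v₀.adicCompletion ℚ) 1 d = 0 → d = 0)
    (hbudget : ∏ v ∈ T, (Nat.card (nsmulAddMonoidHom p :
        (W.baseChange (v.adicCompletion ℚ)).toAffine.Point →+ _).ker *
          Nat.card (v.adicCompletionIntegers ℚ ⧸
            Ideal.span {(p : v.adicCompletionIntegers ℚ)})) ≤ p) :
    BSDp W p := by
  have hpp : p.Prime := hp.out
  classical
  -- strictness at `v₀` in the form of file XIII
  have hstrict' : ∀ c ∈ selmerLocalKer W (v₀.adicCompletion ℚ) (p : ℤ),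
      h1Equiv θ hθ c ∈ A.selmerGroup (p : ℤ) → h1Equiv θ hθ c = 0 := by
    intro c hc hcA
    exact hstrict _ hcA (hkill c hc (((mem_selmerGroup_iff A _ _).mp hcA).1 v₀))
  -- enlarge `T` by the places of kind (i), then the strict count of file XIII
  set T' := T ∪ S.filter (fun v ↦ (p : 𝓞 ℚ) ∉ v.asIdeal ∧ Nat.card (nsmulAddMonoidHom p :
      (W.baseChange (v.adicCompletion ℚ)).toAffine.Point →+ _).ker = 1) with hT'
  have hT'S : T' ⊆ S := Finset.union_subset hTS (Finset.filter_subset _ _)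
  have h1 := natCard_selmerGroup_le_of_congr_of_le_off_strict A W hp2 θ hθ S T' hT'S hS
    (fun v hv hvT c hc ↦ ?_) hstrict'
  · refine bsdp_of_natCard_selmerGroup_le W p hGZK hCT hr hirr hSha (h1.trans (le_trans (le_of_eq ?_) hbudget))
    have hsplit' : T' = T ∪ (S.filter (fun v ↦ (p : 𝓞 ℚ) ∉ v.asIdeal ∧ Nat.card (nsmulAddMonoidHom p :
      (W.baseChange (v.adicCompletion ℚ)).toAffine.Point →+ _).ker = 1) \ T) := by
      rw [hT', Finset.union_sdiff_self_eq_union]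
    rw [hsplit', Finset.prod_union Finset.disjoint_sdiff,
      Finset.prod_eq_one (s := _ \ T) (fun v hv ↦ ?_), mul_one]
    · refine Finset.prod_congr rfl fun v _ ↦ ?_
      exact W.natCard_kummerLocalConditionAt_adicCompletion v hpp.ne_zero
    · rw [Finset.mem_sdiff, Finset.mem_filter] at hv
      rw [W.natCard_kummerLocalConditionAt_adicCompletion v hpp.ne_zero, hv.1.2.2, one_mul,
        natCard_quot_adicCompletionIntegers_eq_one hv.1.2.1]
  · have hvT0 : v ∉ T := fun h ↦ hvT (Finset.mem_union_left _ h)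
    have hnot1 : ¬ ((p : 𝓞 ℚ) ∉ v.asIdeal ∧ Nat.card (nsmulAddMonoidHom p :
        (W.baseChange (v.adicCompletion ℚ)).toAffine.Point →+ _).ker = 1) := fun h ↦
      hvT (Finset.mem_union_right _ (Finset.mem_filter.mpr ⟨hv, h⟩))
    rcases hplaces v hv hvT0 with h1 | ⟨hWv, hW'v, hcard⟩ | ⟨hWv, hW'v, hγ', hμ⟩ |
        ⟨ℓ, hℓ, hℓ2, hℓv, hpv, hmult, hγ', hAv⟩ | ⟨hpv, hmult, hγ', hAv⟩ |
        ⟨ℓ, hℓ, hℓ2, hℓv, hpv, hWv, hmultA, hγA⟩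
    · exact absurd h1 hnot1
    · exact A.h1Equiv_mem_selmerLocalKer_of_hasSplitMultiplicativeReductionAt v hU W θ hθ hWv
        hW'v hcard hc
    · exact A.h1Equiv_mem_selmerLocalKer_of_hasMultiplicativeReductionAt v hU2 hp2 W θ hθ hWv
        hW'v hγ' hμ hc
    · haveI := hℓ
      exact h1Equiv_mem_selmerLocalKer_of_nonsplit_of_good_rat W A p hU2 hp2 θ hθ hℓ2 hℓv hmult
        hγ' hAv hpv hc
    · exact h1Equiv_mem_selmerLocalKer_of_nonsplit_of_good_at_p W A p hU2 hp2 θ hθ hpv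
        (hEP v hpv) hmult hγ' hAv hc
    · haveI := hℓ
      exact h1Equiv_mem_selmerLocalKer_of_good_of_nonsplit_rat W A p hU2 hp2 θ hθ hℓ2 hℓv hWv
        hmultA hγA hpv hc

end Rat

end Summit.BirchSwinnertonDyer.Rank1Residual.X11a.SelmerCompanion

end
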